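import Summits.RiemannHypothesis.RiemannHypothesis.Theorems.WeilColumnThetaWitness
import Literature.NumberTheory.LFunctions.WeilWindowSimpleEven
import Literature.NumberTheory.LFunctions.WeilGroundEnergyProofs
import HarnessLib

/-!
# The TRUNCATED witness pieces `G_R = G₀ψ_R`, `T_R = G_R(1−χ)`, `E_R = G₀(1−ψ_R)` and the polarisation split (PR bookkeeping)

WEIL column (LADDER-RH, W-P(P2); tier-1 `ThetaCertificateSound`, item PR of THETA-ASSIGN v1.0 §3 = WEIL-THEORY-R3 v1.3 §3⁗).
`G₀ = e^{x/2}Θ(eˣ)` is not compactly supported (left tail), so the prime-side definition of `W` cannot be applied to `T = G₀(1−χ)`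
directly inside the test class. With the smooth step `ψ_R` (`= 0` on `(−∞, −R−1]`, `= 1` on `[−R, ∞)`, Mathlib `Real.smoothTransition`):
* DEFS `smoothStep R`, `P.GR R = G₀·ψ_R`, `P.TR R = GR·(1−χ)`, `P.ER R = G₀·(1−ψ_R)` and their odd parts `P.GROdd`, `P.TROdd`, `P.EROdd`;
* `G₀ = GR + ER`, `oddProfile Θ = GROdd + EROdd`; for `R ≥ a` and a cut vanishing on `(−∞, −a]`: **`g = GR − TR`**, `gOdd = GROdd − TROdd`;
* supports: `GR`, `TR` vanish on `(−∞, −R−1]`; `G₀` (hence `GR`, `g`) vanishes on `(a, ∞)` (`G₀_eq_zero_of_lt`); `ER` vanishes on `[−R, ∞)`;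
* `weilQuadratic_sub_polarisation`: `Q(A − B) = Q(B) + (Q(A) − W(A⋆B̃) − W(B⋆Ã))` for test functions — the split whose bracket the
  zero side kills (`WeilColumnZeroSideBilinear`, `WeilColumnTailMellinDecay`) and whose main term `Q(T_R⁻ ⋆ moll_k)` the lane's
  D5/D6/D7 bound on the prime side.
RH-free; nothing here bears on the truth of RH.
-/

set_option linter.dupNamespace false

noncomputable section

open MeasureTheory Set Complex Filter
open scoped Real
open Literature.NumberTheory.LFunctions

namespace Summit.RiemannHypothesis.RiemannHypothesis.Theorems.WeilColumn.ThetaMellin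

/-! ## The smooth step -/

/-- `ψ_R(x) = smoothTransition(x + R + 1)`: smooth, `0 ≤ ψ_R ≤ 1`, `ψ_R = 0` on `(−∞, −R−1]`, `ψ_R = 1` on `[−R, ∞)`. -/
def smoothStep (R x : ℝ) : ℝ := Real.smoothTransition (x + R + 1)

/-- `ψ_R = 1` on `[−R, ∞)`. [folklore] -/
theorem smoothStep_eq_one {R x : ℝ} (hx : -R ≤ x) : smoothStep R x = 1 :=
  Real.smoothTransition.one_of_one_le (by linarith)

/-- `ψ_R = 0` on `(−∞, −R−1]`. [folklore] -/
theorem smoothStep_eq_zero {R x : ℝ} (hx : x ≤ -R - 1) : smoothStep R x = 0 :=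
  Real.smoothTransition.zero_of_nonpos (by linarith)

/-- `0 ≤ ψ_R ≤ 1`. [folklore] -/
theorem smoothStep_mem_Icc (R x : ℝ) : smoothStep R x ∈ Icc (0 : ℝ) 1 :=
  ⟨Real.smoothTransition.nonneg _, Real.smoothTransition.le_one _⟩

/-- `ψ_R` is smooth. [folklore] -/
theorem contDiff_smoothStep (R : ℝ) {n : ℕ∞} : ContDiff ℝ n (smoothStep R) :=
  Real.smoothTransition.contDiff.comp ((contDiff_id.add contDiff_const).add contDiff_const)

/-- `ψ_R` is continuous. [folklore] -/
theorem continuous_smoothStep (R : ℝ) : Continuous (smoothStep R) :=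
  Real.smoothTransition.continuous.comp (by fun_prop)

/-! ## The truncated pieces of the witness -/

namespace ThetaParams

variable (P : ThetaParams)

/-- `G_R = G₀·ψ_R` (compactly supported in `[−R−1, a]`). -/
def GR (R x : ℝ) : ℂ := P.G₀ x * (smoothStep R x : ℂ)
/-- `T_R = G_R·(1 − χ)` (compactly supported in `[−R−1, x₁]`). -/
def TR (R x : ℝ) : ℂ := P.GR R x * ((1 - P.cut x : ℝ) : ℂ)
/-- `E_R = G₀·(1 − ψ_R)` (the truncation error; supported in `(−∞, −R]`). -/
def ER (R x : ℝ) : ℂ := P.G₀ x * ((1 - smoothStep R x : ℝ) : ℂ)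
/-- `G_R⁻`. -/
def GROdd (R x : ℝ) : ℂ := P.GR R x - P.GR R (-x)
/-- `T_R⁻`. -/
def TROdd (R x : ℝ) : ℂ := P.TR R x - P.TR R (-x)
/-- `E_R⁻`. -/
def EROdd (R x : ℝ) : ℂ := P.ER R x - P.ER R (-x)

/-- `G₀ = G_R + E_R`. [folklore] -/
theorem G₀_eq_GR_add_ER (R x : ℝ) : P.G₀ x = P.GR R x + P.ER R x := by
  simp only [GR, ER, Complex.ofReal_sub, Complex.ofReal_one]; ring

/-- `G₀⁻ = G_R⁻ + E_R⁻` (`G₀⁻ = oddProfile Θ`). [folklore] -/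
theorem oddProfile_eq_GROdd_add_EROdd (R x : ℝ) : oddProfile P.Θ x = P.GROdd R x + P.EROdd R x := by
  have h1 : expProfile P.Θ x = P.GR R x + P.ER R x := P.G₀_eq_GR_add_ER R x
  have h2 : expProfile P.Θ (-x) = P.GR R (-x) + P.ER R (-x) := P.G₀_eq_GR_add_ER R (-x)
  simp only [oddProfile, GROdd, EROdd, h1, h2]; ring

/-- `E_R = 0` on `[−R, ∞)`. [folklore] -/
theorem ER_eq_zero {R x : ℝ} (hx : -R ≤ x) : P.ER R x = 0 := by
  simp [ER, smoothStep_eq_one hx]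

/-- `G_R = 0` (hence `T_R = 0`) on `(−∞, −R−1]`. [folklore] -/
theorem GR_eq_zero_of_le {R x : ℝ} (hx : x ≤ -R - 1) : P.GR R x = 0 := by
  simp [GR, smoothStep_eq_zero hx]

/-- `T_R = 0` on `(−∞, −R−1]`. [folklore] -/
theorem TR_eq_zero_of_le {R x : ℝ} (hx : x ≤ -R - 1) : P.TR R x = 0 := by
  simp [TR, P.GR_eq_zero_of_le hx]

/-- **`G₀ = 0` above the window**: for `x > a`, `Θ(eˣ) = 0` (every `n·eˣ/λ > eᵃ/λ = c₂` lies outside the profile's support),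
given `1 ≤ m`, `0 ≤ ε`, `c₁ + ε ≤ m₀ ≤ c₂ − ε`, `0 < c₂`. [folklore] -/
theorem G₀_eq_zero_of_lt {qn : ℕ} (hP : P.Admissible qn) {x : ℝ} (hx : P.a < x) : P.G₀ x = 0 := by
  have hm : 1 ≤ P.m := le_trans (by norm_num) hP.three_le
  have hε : 0 ≤ P.ε := by have := hP.delta_pos; have := hP.c₂_pos; unfold ε; positivity
  have hc₂ := hP.c₂_pos
  have hΘ : P.Θ (Real.exp x) = 0 := by
    rw [Θ_apply]
    refine (tsum_congr fun n => ?_).trans tsum_zero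
    refine Function.notMem_support.mp fun hmem => ?_
    have hsub := support_profile_subset (α := P.α) hm hε hP.seed₂.le hP.seed₁.le hmem
    -- the argument exceeds c₂
    have hlam : P.lam = Real.exp P.a / P.c₂ := rfl
    have hn : (1 : ℝ) ≤ ((n + 1 : ℕ) : ℝ) := by exact_mod_cast Nat.succ_le_succ (Nat.zero_le n)
    have hea : Real.exp P.a < Real.exp x := Real.exp_lt_exp.mpr hx
    have hgt : P.c₂ < (((n + 1 : ℕ) : ℝ) * Real.exp x) / P.lam := by
      rw [hlam, div_div_eq_mul_div, lt_div_iff₀ (Real.exp_pos _)]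
      have h1 : Real.exp x ≤ ((n + 1 : ℕ) : ℝ) * Real.exp x := le_mul_of_one_le_left (Real.exp_pos x).le hn
      nlinarith [Real.exp_pos x, Real.exp_pos P.a]
    exact absurd hsub.2 (not_le.mpr hgt)
  simp [G₀, expProfile, hΘ]

/-- `G_R = 0` above the window. [folklore] -/
theorem GR_eq_zero_of_lt {qn : ℕ} (hP : P.Admissible qn) {R x : ℝ} (hx : P.a < x) : P.GR R x = 0 := by
  simp [GR, P.G₀_eq_zero_of_lt hP hx]

/-- **The exact split `g = G_R − T_R`** for `R ≥ a`, given that the cut vanishes on `(−∞, −a]` (W3). [folklore] -/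
theorem g_eq_GR_sub_TR {R : ℝ} (hR : P.a ≤ R) (hcut0 : ∀ x, x ≤ -P.a → P.cut x = 0) (x : ℝ) :
    P.g x = P.GR R x - P.TR R x := by
  by_cases hx : x ≤ -P.a
  · -- both sides vanish: χ(x) = 0
    simp [g, TR, GR, hcut0 x hx]
  · have hψ : smoothStep R x = 1 := smoothStep_eq_one (by rw [not_le] at hx; linarith)
    simp only [g, TR, GR, hψ, Complex.ofReal_one, mul_one, Complex.ofReal_sub]
    ring

/-- Hence `g⁻ = G_R⁻ − T_R⁻`. [folklore] -/
theorem gOdd_eq_GROdd_sub_TROdd {R : ℝ} (hR : P.a ≤ R) (hcut0 : ∀ x, x ≤ -P.a → P.cut x = 0) (x : ℝ) :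
    P.gOdd x = P.GROdd R x - P.TROdd R x := by
  simp only [gOdd, GROdd, TROdd, P.g_eq_GR_sub_TR hR hcut0]; ring

/-- `T_R − T = −E_R·(1−χ)`: the truncated tail differs from `T` only on `(−∞, −R]`. [folklore] -/
theorem TR_sub_T (R x : ℝ) : P.TR R x - P.T x = -(P.ER R x * ((1 - P.cut x : ℝ) : ℂ)) := by
  simp only [TR, T, GR, ER, Complex.ofReal_sub, Complex.ofReal_one]; ring

end ThetaParams

/-! ## The polarisation split with a minus sign -/

/-- `weilConv g (c·h) = c·weilConv g h` pointwise. [folklore] -/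
theorem weilConv_const_mul_right (g h : ℝ → ℂ) (c : ℂ) (t : ℝ) :
    weilConv g (fun u => c * h u) t = c * weilConv g h t := by
  rw [weilConv_apply, weilConv_apply, ← integral_const_mul]
  refine integral_congr_ae (Eventually.of_forall fun u => ?_)
  ring

/-- `weilConv (c·g) h = c·weilConv g h` pointwise. [folklore] -/
theorem weilConv_const_mul_left (g h : ℝ → ℂ) (c : ℂ) (t : ℝ) :
    weilConv (fun u => c * g u) h t = c * weilConv g h t := by
  rw [weilConv_apply, weilConv_apply, ← integral_const_mul]
  refine integral_congr_ae (Eventually.of_forall fun u => ?_)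
  ring

/-- `(−B)~ = −B̃`. [folklore] -/
theorem weilReflect_neg_one_mul (B : ℝ → ℂ) : weilReflect (fun t => (-1 : ℂ) * B t) = fun t => (-1 : ℂ) * weilReflect B t := by
  funext t; simp [weilReflect, map_neg]

/-- **Polarisation with a minus sign**: for Weil test functions `A, B`,
`Q(A − B) = Q(B) + (Q(A) − W(A ⋆ B̃) − W(B ⋆ Ã))`. [cite: Bombieri2000Weil, §3 (the hermitian form attached to T)] -/
theorem weilQuadratic_sub_polarisation {A B : ℝ → ℂ} (hA : IsWeilTest A) (hB : IsWeilTest B) :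
    weilQuadratic (fun t => A t - B t) =
      weilQuadratic B + (weilQuadratic A - weilFunctional (weilConv A (weilReflect B)) - weilFunctional (weilConv B (weilReflect A))) := by
  have hB' : IsWeilTest (fun t => (-1 : ℂ) * B t) := hB.const_mul (-1)
  have e : (fun t => A t - B t) = A + fun t => (-1 : ℂ) * B t := by funext t; simp [Pi.add_apply]; ring
  rw [e, weilQuadratic_add hA hB', weilQuadratic_const_mul, weilReflect_neg_one_mul]
  have h1 : weilConv A (fun t => (-1 : ℂ) * weilReflect B t) = fun t => (-1 : ℂ) * weilConv A (weilReflect B) t :=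
    funext fun t => weilConv_const_mul_right _ _ _ _
  have h2 : weilConv (fun t => (-1 : ℂ) * B t) (weilReflect A) = fun t => (-1 : ℂ) * weilConv B (weilReflect A) t :=
    funext fun t => weilConv_const_mul_left _ _ _ _
  rw [h1, h2, weilFunctional_const_mul, weilFunctional_const_mul]
  simp [Complex.normSq_neg, Complex.normSq_one]
  ring

end Summit.RiemannHypothesis.RiemannHypothesis.Theorems.WeilColumn.ThetaMellin
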